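import Mathlib.Data.ZMod.Basic
import Mathlib.Tactic
import HarnessLib

/-!
# Bookkeeping for `μ₄`-sheet pairs on `C_p ⋊ C₈`: the sheet predicate on `ℤ/4 × ℤ/4 × ℤ/8`, and periodic functions on `ℤ/p`

COR-CM (cell `pub-hodgecm2`), binder seat b04 (gen 28), count-neutral claim CYCLIC-SEMIDIRECT-EIGHT-DEGENERATE, part V-a (Mathlib only;
theorems, no definition, no named fact, no `sorry`; `HC_CM` neither used nor claimed).  A CM set of `C_p ⋊ C₈` (`c₀ = y⁴`) is a pair of
sheets `k₀, k₁ : ℤ/p → ℤ/4`: `⟨v, s⟩ ∈ T(k₀,k₁)` iff `P(k₀ v, k₁ v, s)` with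
`P(a, b, s) := s ∈ {2a, 2a+2} ∨ s ∈ {2b+1, 2b+3}` (`2a` = the even residue `2·a.val mod 8`).  The finite facts about `P` used by
part V (`CorCM/GaloisCyclicSemidirectEightNormPairs`) are `decide`d here once (the `Decidable` instances of these 8–16-atom statements
exceed the default `synthInstance.maxSize`, hence the option), together with «a function on `ℤ/p` invariant under a non-zero translation
is constant».

* `normPred_four_add` (CM set for `c₀`), `normPred_sheets` (the sheets read on `ℤ/4`; `2t` determines `t`; `a ≠ a+1`),
  `normPred_even_shift` (an even left stabiliser shifts the even sheet), `normPred_odd` (no odd left stabiliser),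
  `apply_eq_apply_of_forall_add`.
-/

namespace Summit.HodgeConjecture.CorCM.GaloisCyclicSemidirectEight

set_option synthInstance.maxSize 2048 in
/-- `T(k₀,k₁)` is a CM set for `c₀ = y⁴`: `P(a,b,4+s) ↔ ¬P(a,b,s)`. [folklore] -/
theorem normPred_four_add : ∀ (a b : ZMod 4) (s : ZMod 8),
    (4 + s = ((2 * a.val : ℕ) : ZMod 8) ∨ 4 + s = ((2 * a.val : ℕ) : ZMod 8) + 2 ∨
        4 + s = ((2 * b.val : ℕ) : ZMod 8) + 1 ∨ 4 + s = ((2 * b.val : ℕ) : ZMod 8) + 3) ↔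
      ¬ (s = ((2 * a.val : ℕ) : ZMod 8) ∨ s = ((2 * a.val : ℕ) : ZMod 8) + 2 ∨
          s = ((2 * b.val : ℕ) : ZMod 8) + 1 ∨ s = ((2 * b.val : ℕ) : ZMod 8) + 3) := by
  decide

set_option synthInstance.maxSize 2048 in
/-- The sheets read on `ℤ/4`: `P(a,b,2t) ↔ t ∈ {a, a+1}`, `P(a,b,2t+1) ↔ t ∈ {b, b+1}`; and `2t` determines `t`. [folklore] -/
theorem normPred_sheets : ∀ (t a b : ZMod 4),
    ((((2 * t.val : ℕ) : ZMod 8) = ((2 * a.val : ℕ) : ZMod 8) ∨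
          ((2 * t.val : ℕ) : ZMod 8) = ((2 * a.val : ℕ) : ZMod 8) + 2 ∨
        ((2 * t.val : ℕ) : ZMod 8) = ((2 * b.val : ℕ) : ZMod 8) + 1 ∨
          ((2 * t.val : ℕ) : ZMod 8) = ((2 * b.val : ℕ) : ZMod 8) + 3) ↔ t = a ∨ t = a + 1) ∧
    ((((2 * t.val : ℕ) : ZMod 8) + 1 = ((2 * a.val : ℕ) : ZMod 8) ∨
          ((2 * t.val : ℕ) : ZMod 8) + 1 = ((2 * a.val : ℕ) : ZMod 8) + 2 ∨
        ((2 * t.val : ℕ) : ZMod 8) + 1 = ((2 * b.val : ℕ) : ZMod 8) + 1 ∨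
          ((2 * t.val : ℕ) : ZMod 8) + 1 = ((2 * b.val : ℕ) : ZMod 8) + 3) ↔ t = b ∨ t = b + 1) ∧
    (((2 * t.val : ℕ) : ZMod 8) = ((2 * a.val : ℕ) : ZMod 8) → t = a) ∧ a ≠ a + 1 := by
  decide

set_option synthInstance.maxSize 4096 in
/-- An EVEN left stabiliser `⟨v₀, s₀⟩` shifts the even sheet: from the memberships of the images of `⟨v, 2k₀(v)⟩`, `⟨v, 2k₀(v)+2⟩`
(`a = k₀(v)`, `(c, d) = (k₀, k₁)(v₀ + v)`) one gets `s₀ + 2a = 2c`. [folklore] -/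
theorem normPred_even_shift : ∀ (a c d : ZMod 4) (s₀ : ZMod 8), s₀.val % 2 = 0 →
    (s₀ + ((2 * a.val : ℕ) : ZMod 8) = ((2 * c.val : ℕ) : ZMod 8) ∨
          s₀ + ((2 * a.val : ℕ) : ZMod 8) = ((2 * c.val : ℕ) : ZMod 8) + 2 ∨
        s₀ + ((2 * a.val : ℕ) : ZMod 8) = ((2 * d.val : ℕ) : ZMod 8) + 1 ∨
          s₀ + ((2 * a.val : ℕ) : ZMod 8) = ((2 * d.val : ℕ) : ZMod 8) + 3) →
    (s₀ + ((2 * a.val : ℕ) : ZMod 8) + 2 = ((2 * c.val : ℕ) : ZMod 8) ∨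
          s₀ + ((2 * a.val : ℕ) : ZMod 8) + 2 = ((2 * c.val : ℕ) : ZMod 8) + 2 ∨
        s₀ + ((2 * a.val : ℕ) : ZMod 8) + 2 = ((2 * d.val : ℕ) : ZMod 8) + 1 ∨
          s₀ + ((2 * a.val : ℕ) : ZMod 8) + 2 = ((2 * d.val : ℕ) : ZMod 8) + 3) →
    s₀ + ((2 * a.val : ℕ) : ZMod 8) = ((2 * c.val : ℕ) : ZMod 8) := by
  decide

set_option synthInstance.maxSize 4096 in
/-- NO ODD left stabiliser: the images of `⟨v, 2k₀v⟩, ⟨v, 2k₀v+2⟩` (in the fibre of `v′ = v₀ − v`, sheets `(c,d)`) and of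
`⟨v′, 2k₁v′+1⟩, ⟨v′, 2k₁v′+3⟩` (back in the fibre of `v`, sheets `(a,b)`) cannot all lie in `T`. [folklore] -/
theorem normPred_odd : ∀ (a b c d : ZMod 4) (s₀ : ZMod 8), s₀.val % 2 = 1 →
    (s₀ + ((2 * a.val : ℕ) : ZMod 8) = ((2 * c.val : ℕ) : ZMod 8) ∨
          s₀ + ((2 * a.val : ℕ) : ZMod 8) = ((2 * c.val : ℕ) : ZMod 8) + 2 ∨
        s₀ + ((2 * a.val : ℕ) : ZMod 8) = ((2 * d.val : ℕ) : ZMod 8) + 1 ∨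
          s₀ + ((2 * a.val : ℕ) : ZMod 8) = ((2 * d.val : ℕ) : ZMod 8) + 3) →
    (s₀ + ((2 * a.val : ℕ) : ZMod 8) + 2 = ((2 * c.val : ℕ) : ZMod 8) ∨
          s₀ + ((2 * a.val : ℕ) : ZMod 8) + 2 = ((2 * c.val : ℕ) : ZMod 8) + 2 ∨
        s₀ + ((2 * a.val : ℕ) : ZMod 8) + 2 = ((2 * d.val : ℕ) : ZMod 8) + 1 ∨
          s₀ + ((2 * a.val : ℕ) : ZMod 8) + 2 = ((2 * d.val : ℕ) : ZMod 8) + 3) →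
    (s₀ + ((2 * d.val : ℕ) : ZMod 8) + 1 = ((2 * a.val : ℕ) : ZMod 8) ∨
          s₀ + ((2 * d.val : ℕ) : ZMod 8) + 1 = ((2 * a.val : ℕ) : ZMod 8) + 2 ∨
        s₀ + ((2 * d.val : ℕ) : ZMod 8) + 1 = ((2 * b.val : ℕ) : ZMod 8) + 1 ∨
          s₀ + ((2 * d.val : ℕ) : ZMod 8) + 1 = ((2 * b.val : ℕ) : ZMod 8) + 3) →
    ¬ (s₀ + ((2 * d.val : ℕ) : ZMod 8) + 3 = ((2 * a.val : ℕ) : ZMod 8) ∨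
          s₀ + ((2 * d.val : ℕ) : ZMod 8) + 3 = ((2 * a.val : ℕ) : ZMod 8) + 2 ∨
        s₀ + ((2 * d.val : ℕ) : ZMod 8) + 3 = ((2 * b.val : ℕ) : ZMod 8) + 1 ∨
          s₀ + ((2 * d.val : ℕ) : ZMod 8) + 3 = ((2 * b.val : ℕ) : ZMod 8) + 3) := by
  decide

/-- A function on `ℤ/p` invariant under a non-zero translation is constant. [folklore] -/
theorem apply_eq_apply_of_forall_add {p : ℕ} [Fact p.Prime] {β : Type} (k : ZMod p → β) {u : ZMod p} (hu : u ≠ 0)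
    (h : ∀ v, k (u + v) = k v) (v w : ZMod p) : k v = k w := by
  have key : ∀ (n : ℕ) (v : ZMod p), k ((n : ZMod p) * u + v) = k v := by
    intro n
    induction n with
    | zero => intro v; simp
    | succ n ih =>
      intro v
      rw [show ((n + 1 : ℕ) : ZMod p) * u + v = u + ((n : ZMod p) * u + v) by push_cast; ring, h, ih]
  have := key ((v - w) * u⁻¹).val w
  rwa [ZMod.natCast_zmod_val, inv_mul_cancel_right₀ hu, sub_add_cancel] at this

end Summit.HodgeConjecture.CorCM.GaloisCyclicSemidirectEight
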